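import Mathlib.AlgebraicGeometry.Stalk
import HarnessLib

/-!
# Generizations of a point whose local ring is a domain ([Stacks 01J7]; [GortzWedhorn2020] §(3.4))

Topic `Literature/AlgebraicGeometry/Morphisms`, namespace `Literature.AlgebraicGeometry.Morphisms`.  Mathlib-only scheme topology,
THEOREMS only (no def, no instance, no notation, no named fact, no `sorry`).

For a scheme `X` and a point `x` the canonical morphism `Spec 𝒪_{X,x} → X` has image exactly the set of generizations of `x`
(Mathlib `Scheme.range_fromSpecStalk`, [Stacks 01J7]).  Hence, when the local ring `𝒪_{X,x}` is a DOMAIN (e.g. `x` a regular point: `X`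
smooth over a discrete valuation ring), the image `ξ` of the generic point of `Spec 𝒪_{X,x}` is a generization of `x` which generizes EVERY
generization of `x` («`x` lies on exactly one irreducible component», [GortzWedhorn2020] §(3.4)):

* `exists_specializes_forall_specializes_of_isDomain_stalk` — `∃ ξ ⤳ x, ∀ y ⤳ x, ξ ⤳ y`;
* `inter_nonempty_of_specializes_of_isDomain_stalk` — two open sets each containing a generization of `x` meet (both contain `ξ`);
* `mem_of_specializes_of_isDomain_stalk` — if `U ⊆ G` with `U` and `G ∖ U` open («`U` clopen in the open `G`») and `y₁, y₂ ⤳ x` with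
  `y₁ ∈ U`, `y₂ ∈ G`, then `y₂ ∈ U`; `mem_of_isClopen_of_specializes_of_isDomain_stalk` — the case `G = X`;
* `specializes_base_closedPoint` — for a local ring `R` and `f : Spec R → X`, every `f p` is a generization of `f 𝔪` (bookkeeping).

Use (cell `hodgecm-mathlib`, F0P5a, letter `SmoothProperModelSeparatesNabla` of the line `F0_D9opRoad2`): two integral points of a smooth model
through the same point of the special fibre have their generic points in the same open-and-closed subset of the generic fibre.

## References
* [StacksProject] The Stacks Project, Tag 01J7 (Schemes, Lemma 26.13.2: points of `Spec 𝒪_{X,x}` ↔ generizations of `x`).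
* [GortzWedhorn2020] U. Görtz, T. Wedhorn, *Algebraic Geometry I*, 2nd ed. (2020), §(3.4) (generizations, irreducible components and
  minimal primes of the local ring), Prop. 3.27.
-/

set_option autoImplicit false

noncomputable section

open CategoryTheory AlgebraicGeometry Topology IsLocalRing

universe u

namespace Literature.AlgebraicGeometry.Morphisms

/-- **A point with integral local ring has a largest generization**: if `𝒪_{X,x}` is a domain, the image `ξ` of the generic point of
`Spec 𝒪_{X,x}` under `Spec 𝒪_{X,x} → X` generizes `x` and every generization of `x` (the generizations of `x` are exactly the image of
`Spec 𝒪_{X,x}`, [Stacks 01J7], and `(0)` generizes every prime). [cite: StacksProject, Tag 01J7] [cite: GortzWedhorn2020, Section (3.4), display (3.4.1)] -/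
theorem exists_specializes_forall_specializes_of_isDomain_stalk {X : Scheme.{u}} (x : X) [IsDomain (X.presheaf.stalk x)] :
    ∃ ξ : X, ξ ⤳ x ∧ ∀ y : X, y ⤳ x → ξ ⤳ y := by
  refine ⟨X.fromSpecStalk x (⊥ : PrimeSpectrum (X.presheaf.stalk x)), ?_, fun y hy => ?_⟩
  · have : X.fromSpecStalk x (⊥ : PrimeSpectrum (X.presheaf.stalk x)) ∈ Set.range (X.fromSpecStalk x) := ⟨_, rfl⟩
    rw [Scheme.range_fromSpecStalk] at this
    exact this
  · have hy' : y ∈ Set.range (X.fromSpecStalk x) := by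
      rw [Scheme.range_fromSpecStalk]; exact hy
    obtain ⟨p, rfl⟩ := hy'
    exact ((PrimeSpectrum.le_iff_specializes _ _).mp bot_le).map (X.fromSpecStalk x).continuous

/-- **Two open sets containing generizations of a point with integral local ring meet** (both contain the largest generization).
[cite: StacksProject, Tag 01J7] [cite: GortzWedhorn2020, Section (3.4), display (3.4.1)] -/
theorem inter_nonempty_of_specializes_of_isDomain_stalk {X : Scheme.{u}} {x y₁ y₂ : X} [IsDomain (X.presheaf.stalk x)]
    (h₁ : y₁ ⤳ x) (h₂ : y₂ ⤳ x) {U V : Set X} (hU : IsOpen U) (hV : IsOpen V) (hy₁ : y₁ ∈ U) (hy₂ : y₂ ∈ V) :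
    (U ∩ V).Nonempty := by
  obtain ⟨ξ, -, hξ⟩ := exists_specializes_forall_specializes_of_isDomain_stalk x
  exact ⟨ξ, (hξ y₁ h₁).mem_open hU hy₁, (hξ y₂ h₂).mem_open hV hy₂⟩

/-- **Generizations of a point with integral local ring lie in the same relatively open-and-closed set**: if `U ⊆ G ⊆ X` with `U` and
`G ∖ U` open, and `y₁ ∈ U`, `y₂ ∈ G` both generize a point `x` whose local ring is a domain, then `y₂ ∈ U`.
[cite: StacksProject, Tag 01J7] [cite: GortzWedhorn2020, Section (3.4), display (3.4.1)] -/
theorem mem_of_specializes_of_isDomain_stalk {X : Scheme.{u}} {x y₁ y₂ : X} [IsDomain (X.presheaf.stalk x)]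
    (h₁ : y₁ ⤳ x) (h₂ : y₂ ⤳ x) {U G : Set X} (hU : IsOpen U) (hGU : IsOpen (G \ U)) (hy₁ : y₁ ∈ U) (hy₂ : y₂ ∈ G) :
    y₂ ∈ U := by
  by_contra hy₂U
  obtain ⟨t, htU, htGU⟩ := inter_nonempty_of_specializes_of_isDomain_stalk h₁ h₂ hU hGU hy₁ ⟨hy₂, hy₂U⟩
  exact htGU.2 htU

/-- **Generizations of a point with integral local ring lie in the same open-and-closed set** (`G = X`).
[cite: StacksProject, Tag 01J7] [cite: GortzWedhorn2020, Section (3.4), display (3.4.1)] -/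
theorem mem_of_isClopen_of_specializes_of_isDomain_stalk {X : Scheme.{u}} {x y₁ y₂ : X} [IsDomain (X.presheaf.stalk x)]
    (h₁ : y₁ ⤳ x) (h₂ : y₂ ⤳ x) {U : Set X} (hU : IsClopen U) (hy₁ : y₁ ∈ U) : y₂ ∈ U :=
  mem_of_specializes_of_isDomain_stalk h₁ h₂ (G := Set.univ) hU.2
    (by rw [← Set.compl_eq_univ_sdiff]; exact hU.1.isOpen_compl) hy₁ (Set.mem_univ _)

/-- For a local ring `R` and a morphism `f : Spec R → X`, the image of every point of `Spec R` generizes the image of the closed point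
(every prime lies in the maximal ideal; continuity). [cite: StacksProject, Tag 01J7] -/
theorem specializes_base_closedPoint {R : CommRingCat.{u}} [IsLocalRing R] {X : Scheme.{u}} (f : Spec R ⟶ X) (p : Spec R) :
    f p ⤳ f (closedPoint R) :=
  (IsLocalRing.specializes_closedPoint p).map f.continuous

end Literature.AlgebraicGeometry.Morphisms

end
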